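import Summits.Ventures.HSemireg.WedgeWeilDegRank

/-!
# Venture HSemireg — MOD-4 line: the TAGS of THEOREM R_f's middle degree in th-7's wedge model
# (families (c)/(c′) of the proof sheet §4: a block monomial with a doubled site is killed by `f` and by its own block vector
# and tagged by the other one; the tags are distinct basis monomials, `C(2n,n) − 2ⁿ` of them per block)

HONEST FRAMING. Part of the Lean index of the computation cell `pub-hsemireg` (widening group W3, seat w3-mod4-1 gen 5; files
of record `HOME/widen/W3/MOD4-OFFSPLIT-w3mod4.md` §10.2 / §11, `MOD4-THEOREM-RF-PROOF-w3mod4.md` v1.0 §2 (P4), §3 (c), §4).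
Finite-dimensional exterior algebra over a field ONLY (th-7's sign-free transposed wedge model, tree files `Wedge*.lean`): no
abelian variety, no sheaf, no Ext group, no semiregularity map; nothing here says that HC, HC_CM or HC_AV holds; no Literature fact
is declared or used; THEOREM R_f is NOT asserted here.  WHAT IS PROVED, in the Weil model `v = Wedge.Weil.vW K N p q a b =
w_N(q) + a·E_{Gm} + b·E_{Dm}` (blocks `Dm N p` = the generators of the first `p` pairs, `Gm N p` = the rest):
* `B_pair_mul_vW` — a block-`D` monomial `E_t` (`t ⊆ Dm`) containing a full pair `{i, pt i}` satisfies
  `E_t ∧ v = (a·u(t,Gm)) · E_{t ∪ Gm}` («(P1): `(xy)(x − λy) = 0` kills `f`; `E_t ∧ E_{Dm} = 0`; the TAG `E_{t ∪ Gm}`», with th-7's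
  unit structure constant `u`);
* `map_vW_Sp_pairD` — for `a ≠ 0` the image of the span of these monomials (degree `m`) is the span of the tags
  `{E_{t ∪ Gm}}`, and `finrank_map_vW_Sp_pairD` — its dimension is the NUMBER of block-`D` `m`-sets with a full pair (the tags are
  distinct basis monomials: `t ↦ t ∪ Gm` is injective on `t ⊆ Dm`); no definitions are introduced (the predicates are lambdas);
* `card_pairD_middle` — in type `(n,n)` and degree `n` that number is `C(2n,n) − 2ⁿ` (all `n`-subsets of the `2n` block generators
  minus the `2ⁿ` pair-free ones = the selection words `μ_B`, counted by `card_selD` via the bijection with `Fin n → Bool`).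
Hence family (c) contributes exactly `C(2n,n) − 2ⁿ` to `R_n` (and (c′) likewise by the block symmetry), as in the proof sheet.
All statements and proofs: w3-mod4-1 g5 (2026-08-23).  Namespace `Summit.Ventures.HSemireg.Mod4Site`.
-/

namespace Summit.Ventures.HSemireg.Mod4Site

open Module Summit.Ventures.HSemireg.Wedge Summit.Ventures.HSemireg.Wedge.Hankel Summit.Ventures.HSemireg.Wedge.Weil

variable {K : Type*} [Field K] {N : ℕ}

/-! ### §1 A block monomial with a doubled site: killed by `f` and by its own block vector, tagged by the other -/

/-- **(P4)/(c) of the proof sheet:** for `t ⊆ Dm` containing a full pair `{i, pt i}`: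
`E_t ∧ v = (a · u(t, Gm)) · E_{t ∪ Gm}`. -/
theorem B_pair_mul_vW {p : ℕ} {t : Finset (In N)} (ht : t ⊆ Dm N p) {i : In N} (hi : i ∈ t) (hpi : pt i ∈ t)
    (q : ℕ → K) (a b : K) :
    B K (In N) t * vW K N p q a b = (a * u K t (Gm N p)) • B K (In N) (t ∪ Gm N p) := by
  have hD : ¬ Disjoint t (Dm N p) := fun h => Finset.disjoint_left.mp h hi (ht hi)
  rw [vW_mul_expand, B_mul_f_eq_zero_of_pair K hi hpi, zero_add, B_mul_B, B_mul_B, u_eq_zero K hD, zero_smul, smul_zero,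
    add_zero, smul_smul]

/-- the structure constant of a tag is a unit: `t ⊆ Dm` is disjoint from `Gm`. -/
lemma u_tag_ne_zero {p : ℕ} {t : Finset (In N)} (ht : t ⊆ Dm N p) : u K t (Gm N p) ≠ 0 :=
  (u_ne_zero_iff K).mpr ((disjoint_Dm_Gm p).mono_left ht)

/-! ### §2 The span of the tags
Family (c)'s monomials are the `E_t` with `t ⊆ Dm N p`, `|t| = m`, `t ∋` a full pair — the predicate
`fun t => t ⊆ Dm N p ∧ t.card = m ∧ ∃ i ∈ t, pt i ∈ t` —, and their tags are the `E_{t ∪ Gm}` (no definitions are introduced;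
the predicates are written out). -/

/-- **the image of family (c) is the span of its tags** (`a ≠ 0`). -/
theorem map_vW_Sp_pairD {p m : ℕ} (q : ℕ → K) {a : K} (ha : a ≠ 0) (b : K) :
    (Sp K (fun t : Finset (In N) => t ⊆ Dm N p ∧ t.card = m ∧ ∃ i ∈ t, pt i ∈ t)).map
        (LinearMap.mulRight K (vW K N p q a b)) =
      Sp K (fun r : Finset (In N) => ∃ t, (t ⊆ Dm N p ∧ t.card = m ∧ ∃ i ∈ t, pt i ∈ t) ∧ r = t ∪ Gm N p) := by
  apply le_antisymm
  · rw [Sp, Submodule.map_span, Submodule.span_le]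
    rintro _ ⟨_, ⟨t, ht, rfl⟩, rfl⟩
    have ht' := ht
    obtain ⟨htD, _, i, hi, hpi⟩ := ht'
    rw [LinearMap.mulRight_apply, B_pair_mul_vW htD hi hpi]
    exact Submodule.smul_mem _ _ (B_mem_Sp ⟨t, ht, rfl⟩)
  · rw [Sp, Submodule.span_le]
    rintro _ ⟨r, ⟨t, ht, rfl⟩, rfl⟩
    have ht' := ht
    obtain ⟨htD, _, i, hi, hpi⟩ := ht'
    have hu : a * u K t (Gm N p) ≠ 0 := mul_ne_zero ha (u_tag_ne_zero htD)
    refine ⟨(a * u K t (Gm N p))⁻¹ • B K (In N) t, Submodule.smul_mem _ _ (B_mem_Sp ht), ?_⟩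
    rw [LinearMap.mulRight_apply, smul_mul_assoc, B_pair_mul_vW htD hi hpi, smul_smul, inv_mul_cancel₀ hu, one_smul]

/-- **the tags are distinct basis monomials:** `dim(family (c) ∧ v) = #{t ⊆ Dm : |t| = m, t ∋ a full pair}` (`a ≠ 0`). -/
theorem finrank_map_vW_Sp_pairD {p m : ℕ} (q : ℕ → K) {a : K} (ha : a ≠ 0) (b : K)
    [DecidablePred (fun t : Finset (In N) => t ⊆ Dm N p ∧ t.card = m ∧ ∃ i ∈ t, pt i ∈ t)] :
    Module.finrank K ↥((Sp K (fun t : Finset (In N) => t ⊆ Dm N p ∧ t.card = m ∧ ∃ i ∈ t, pt i ∈ t)).map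
        (LinearMap.mulRight K (vW K N p q a b))) =
      (Finset.univ.filter (fun t : Finset (In N) => t ⊆ Dm N p ∧ t.card = m ∧ ∃ i ∈ t, pt i ∈ t)).card := by
  classical
  rw [map_vW_Sp_pairD q ha b, finrank_Sp]
  -- `t ↦ t ∪ Gm` is a bijection from family (c)'s sets onto the tags
  symm
  refine Finset.card_bij (fun t _ => t ∪ Gm N p) (fun t ht => ?_) (fun t₁ ht₁ t₂ ht₂ h => ?_) (fun r hr => ?_)
  · rw [Finset.mem_filter] at ht ⊢
    exact ⟨Finset.mem_univ _, t, ht.2, rfl⟩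
  · rw [Finset.mem_filter] at ht₁ ht₂
    have h1 : Disjoint t₁ (Gm N p) := (disjoint_Dm_Gm p).mono_left ht₁.2.1
    have h2 : Disjoint t₂ (Gm N p) := (disjoint_Dm_Gm p).mono_left ht₂.2.1
    ext x
    constructor
    · intro hx
      have hx' : x ∈ t₂ ∪ Gm N p := h ▸ Finset.mem_union_left _ hx
      rcases Finset.mem_union.mp hx' with h' | h'
      · exact h'
      · exact (Finset.disjoint_left.mp h1 hx h').elim
    · intro hx
      have hx' : x ∈ t₁ ∪ Gm N p := h.symm ▸ Finset.mem_union_left _ hx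
      rcases Finset.mem_union.mp hx' with h' | h'
      · exact h'
      · exact (Finset.disjoint_left.mp h2 hx h').elim
  · rw [Finset.mem_filter] at hr
    obtain ⟨t, ht, rfl⟩ := hr.2
    exact ⟨t, Finset.mem_filter.mpr ⟨Finset.mem_univ _, ht⟩, rfl⟩

/-! ### §3 The counts in type `(n,n)`, degree `n`: `C(2n,n)` block `n`-sets, `2ⁿ` of them pair-free -/

/-- the `n`-subsets of the block `Dm` (`2n` generators) number `C(2n,n)`; they split into those with a full pair and the
pair-free ones. -/
theorem card_blockD_split (n : ℕ)
    [DecidablePred (fun t : Finset (In (n + n)) => t ⊆ Dm (n + n) n ∧ t.card = n ∧ ∃ i ∈ t, pt i ∈ t)]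
    [DecidablePred (fun t : Finset (In (n + n)) => t ⊆ Dm (n + n) n ∧ t.card = n ∧ ¬ ∃ i ∈ t, pt i ∈ t)] :
    (Finset.univ.filter (fun t : Finset (In (n + n)) => t ⊆ Dm (n + n) n ∧ t.card = n ∧ ∃ i ∈ t, pt i ∈ t)).card +
      (Finset.univ.filter (fun t : Finset (In (n + n)) => t ⊆ Dm (n + n) n ∧ t.card = n ∧ ¬ ∃ i ∈ t, pt i ∈ t)).card =
      (n + n).choose n := by
  classical
  have hD : (Dm (n + n) n).card = n + n := card_Dm (by omega)
  have h1 : (Finset.univ.filter (fun t : Finset (In (n + n)) => t ⊆ Dm (n + n) n ∧ t.card = n ∧ ∃ i ∈ t, pt i ∈ t)) =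
      ((Dm (n + n) n).powersetCard n).filter (fun t => ∃ i ∈ t, pt i ∈ t) := by
    ext t; simp only [Finset.mem_filter, Finset.mem_univ, true_and, Finset.mem_powersetCard, and_assoc]
  have h2 : (Finset.univ.filter (fun t : Finset (In (n + n)) => t ⊆ Dm (n + n) n ∧ t.card = n ∧ ¬ ∃ i ∈ t, pt i ∈ t)) =
      ((Dm (n + n) n).powersetCard n).filter (fun t => ¬ ∃ i ∈ t, pt i ∈ t) := by
    ext t; simp only [Finset.mem_filter, Finset.mem_univ, true_and, Finset.mem_powersetCard, and_assoc]
  rw [h1, h2, Finset.card_filter_add_card_filter_not, Finset.card_powersetCard, hD]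

/-- the generators of the first `n` pairs, as pair indices: `{c' : Fin 2n // c' < n}` has `n` elements. -/
lemma card_filter_lt (n : ℕ) : (Finset.univ.filter (fun c' : Fin (n + n) => (c' : ℕ) < n)).card = n := by
  have h : Finset.univ.filter (fun c' : Fin (n + n) => (c' : ℕ) < n) = Finset.univ.image (Fin.castAdd n) := by
    ext c'
    simp only [Finset.mem_filter, Finset.mem_univ, true_and, Finset.mem_image]
    constructor
    · intro h; exact ⟨⟨c', h⟩, Fin.ext rfl⟩
    · rintro ⟨c, rfl⟩; exact c.is_lt
  rw [h, Finset.card_image_of_injective _ (Fin.castAdd_injective _ _), Finset.card_univ, Fintype.card_fin]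

/-- **the pair-free block `n`-sets are the `2ⁿ` selection words** `μ_B` (one letter from each of the `n` pairs):
bijection with `Fin n → Bool`. -/
theorem card_selD (n : ℕ)
    [DecidablePred (fun t : Finset (In (n + n)) => t ⊆ Dm (n + n) n ∧ t.card = n ∧ ¬ ∃ i ∈ t, pt i ∈ t)] :
    (Finset.univ.filter (fun t : Finset (In (n + n)) => t ⊆ Dm (n + n) n ∧ t.card = n ∧ ¬ ∃ i ∈ t, pt i ∈ t)).card =
      2 ^ n := by
  classical
  -- the letter chosen in pair `c` by `f`
  set L : (Fin n → Bool) → Fin n → In (n + n) :=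
    fun f c => if f c then yJ (n + n) (Fin.castAdd n c) else xJ (n + n) (Fin.castAdd n c) with hL
  have hprL : ∀ f c, pr (L f c) = Fin.castAdd n c := by
    intro f c; simp only [hL]; split_ifs <;> simp
  have hLinj : ∀ f, Function.Injective (L f) := by
    intro f c d h
    have := congrArg pr h
    rw [hprL, hprL] at this
    exact Fin.castAdd_injective _ _ this
  have hLmem : ∀ f c, L f c ∈ Dm (n + n) n := by
    intro f c; rw [mem_Dm_iff, hprL]; exact c.is_lt
  have hLy : ∀ f c, (L f c = yJ (n + n) (Fin.castAdd n c) ↔ f c = true) := by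
    intro f c; simp only [hL]
    constructor
    · intro h; by_contra hf; rw [if_neg hf] at h; exact xJ_ne_yJ _ _ h
    · intro h; rw [if_pos h]
  set φ : (Fin n → Bool) → Finset (In (n + n)) := fun f => Finset.univ.image (L f) with hφ
  have key : ∀ f c, (yJ (n + n) (Fin.castAdd n c) ∈ φ f ↔ f c = true) := by
    intro f c
    simp only [hφ, Finset.mem_image, Finset.mem_univ, true_and]
    constructor
    · rintro ⟨d, hd⟩
      have hdc : d = c := by
        have := congrArg pr hd; rw [hprL, pr_yJ] at this; exact Fin.castAdd_injective _ _ this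
      subst hdc
      exact (hLy f d).mp hd
    · intro h; exact ⟨c, (hLy f c).mpr h⟩
  have hφinj : Function.Injective φ := by
    intro f g h
    funext c
    have h1 := key f c; rw [h] at h1
    have h2 := key g c
    cases hf : f c <;> cases hg : g c
    · rfl
    · exact absurd (h1.mp (h2.mpr hg)) (by rw [hf]; exact Bool.false_ne_true)
    · exact absurd (h2.mp (h1.mpr hf)) (by rw [hg]; exact Bool.false_ne_true)
    · rfl
  have himage : Finset.univ.image φ =
      Finset.univ.filter (fun t : Finset (In (n + n)) => t ⊆ Dm (n + n) n ∧ t.card = n ∧ ¬ ∃ i ∈ t, pt i ∈ t) := by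
    ext t
    simp only [Finset.mem_image, Finset.mem_univ, true_and, Finset.mem_filter]
    constructor
    · rintro ⟨f, rfl⟩
      refine ⟨fun x hx => ?_, ?_, ?_⟩
      · obtain ⟨c, -, rfl⟩ := Finset.mem_image.mp hx; exact hLmem f c
      · rw [Finset.card_image_of_injective _ (hLinj f), Finset.card_univ, Fintype.card_fin]
      · rintro ⟨i, hi, hpi⟩
        obtain ⟨c, -, rfl⟩ := Finset.mem_image.mp hi
        obtain ⟨d, -, hd⟩ := Finset.mem_image.mp hpi
        have hdc : d = c := by
          have := congrArg pr hd; rw [hprL, pr_pt, hprL] at this; exact Fin.castAdd_injective _ _ this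
        subst hdc
        exact pt_ne_self _ hd.symm
    · rintro ⟨hDm, hcard, hnp⟩
      refine ⟨fun c => decide (yJ (n + n) (Fin.castAdd n c) ∈ t), ?_⟩
      -- every pair `c < n` meets `t` exactly once
      have hinj : Set.InjOn pr (t : Set (In (n + n))) := by
        intro i hi j hj hij
        rcases eq_or_eq_pt_of_pr_eq hij with h | h
        · exact h.symm
        · exact absurd ⟨i, hi, h ▸ hj⟩ hnp
      have him : t.image pr = Finset.univ.filter (fun c' : Fin (n + n) => (c' : ℕ) < n) := by
        apply Finset.eq_of_subset_of_card_le
        · intro c' hc'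
          obtain ⟨i, hi, rfl⟩ := Finset.mem_image.mp hc'
          exact Finset.mem_filter.mpr ⟨Finset.mem_univ _, (mem_Dm_iff i).mp (hDm hi)⟩
        · rw [card_filter_lt, Finset.card_image_of_injOn hinj, hcard]
      have hmeet : ∀ c : Fin n, xJ (n + n) (Fin.castAdd n c) ∈ t ∨ yJ (n + n) (Fin.castAdd n c) ∈ t := by
        intro c
        have hc : Fin.castAdd n c ∈ t.image pr := by
          rw [him]; exact Finset.mem_filter.mpr ⟨Finset.mem_univ _, c.is_lt⟩
        obtain ⟨i, hi, hic⟩ := Finset.mem_image.mp hc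
        rcases eq_xJ_or_eq_yJ i with h | h
        · left; rw [← hic, ← h]; exact hi
        · right; rw [← hic, ← h]; exact hi
      apply Finset.eq_of_subset_of_card_le
      · intro x hx
        obtain ⟨c, -, rfl⟩ := Finset.mem_image.mp hx
        by_cases hc : yJ (n + n) (Fin.castAdd n c) ∈ t
        · have : L (fun c => decide (yJ (n + n) (Fin.castAdd n c) ∈ t)) c = yJ (n + n) (Fin.castAdd n c) :=
            (hLy (fun c => decide (yJ (n + n) (Fin.castAdd n c) ∈ t)) c).mpr (decide_eq_true hc)
          rw [this]; exact hc
        · have : L (fun c => decide (yJ (n + n) (Fin.castAdd n c) ∈ t)) c = xJ (n + n) (Fin.castAdd n c) := by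
            simp only [hL]; rw [if_neg (by simpa using hc)]
          rw [this]; exact (hmeet c).resolve_right hc
      · rw [hcard, Finset.card_image_of_injective _ (hLinj _), Finset.card_univ, Fintype.card_fin]
  rw [← himage, Finset.card_image_of_injective _ hφinj, Finset.card_univ, Fintype.card_fun, Fintype.card_bool,
    Fintype.card_fin]

/-- **FAMILY (c) OF THE MIDDLE DEGREE CONTRIBUTES `C(2n,n) − 2ⁿ`** (type `(n,n)`, degree `n`, `a ≠ 0`):
`dim(span{E_t : t ⊆ Dm, |t| = n, t ∋ a full pair} ∧ v) + 2ⁿ = C(2n,n)`; family (c′) likewise with the blocks exchanged. -/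
theorem finrank_tags_middle (n : ℕ) (q : ℕ → K) {a : K} (ha : a ≠ 0) (b : K)
    [DecidablePred (fun t : Finset (In (n + n)) => t ⊆ Dm (n + n) n ∧ t.card = n ∧ ∃ i ∈ t, pt i ∈ t)] :
    Module.finrank K ↥((Sp K (fun t : Finset (In (n + n)) => t ⊆ Dm (n + n) n ∧ t.card = n ∧ ∃ i ∈ t, pt i ∈ t)).map
        (LinearMap.mulRight K (vW K (n + n) n q a b))) + 2 ^ n = (n + n).choose n := by
  classical
  rw [finrank_map_vW_Sp_pairD q ha b, ← card_selD n]
  convert card_blockD_split n using 2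

end Summit.Ventures.HSemireg.Mod4Site
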